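import Summits.CriticalPhenomena.CardyFormulaZ2.Theorems.CardyUSTContinuationKirchhoffExtremalLengthG02Holo2
import Summits.CriticalPhenomena.CardyFormulaZ2.Theorems.CardyUSTContinuationKirchhoffExtremalLengthG02Deriv
import Summits.CriticalPhenomena.CardyFormulaZ2.Theorems.CardyUSTContinuationKirchhoffExtremalLengthG02FatouExhaust

/-!
# The holomorphic limit of the conjugate pairs along arbitrary meshes
# ([GP19] §4.1 / Thm 4.6 for the `meshDomain` / `discreteArc` discretisation)

Support file for `KirchhoffExtremalLength` (route CardyUSTContinuation of `CardyFormulaZ2`, item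
stmt-CriticalPhenomena-11234), towards the upper half of `G02ModulusConvergence` (`…Defs.lean`).
Transposition of `SquareTiling.exists_holomorphic_limit` (§L4 of `SquareTilingHoloLimit.lean`) to
`Ω_δ = discreteDomainGraph Ω δ`, along an ARBITRARY sequence of meshes `δ_n → 0⁺` at which the
discrete arcs are disjoint (`exists_holomorphic_limit'`): the potentials `h_n` of
`exists_g02Potential` and their conjugates `facePot` based at the square of a fixed point
converge locally uniformly (after extraction) to `v`, `u` with `f = u + iv` holomorphic on `Ω`
and `∫∫_Ω ‖f'‖² ≤ lim 𝒞(A_δ ↔ B_δ)`; the interior estimates, the local `C¹` structure and Fatou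
come from `…G02Interior`, `…G02Deriv`, `…G02Fatou(Exhaust)`.
-/

noncomputable section

namespace Summit.CriticalPhenomena.CardyFormulaZ2.Theorems

namespace KirchhoffSlope

open Set Metric Filter Topology SimpleGraph MeasureTheory
open scoped ENNReal NNReal
open Literature.Probability Literature.Probability.LatticeModels Literature.Probability.Percolation
open Literature.Probability.LatticeModels.SquareTiling (stepFlux walkFlux closedSq floorSq mem_closedSq_floorSq
  sqz unsqz sqz_mem_Ioo sqz_mem_Icc sqz_strictMono abs_sqz_sub_sqz_le unsqz_sqz sqz_unsqz continuousOn_unsqz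
  uniformContinuousOn_unsqz nearestSite_add_right nearestSite_add_up norm_smul_reCLM_add_smul_imCLM hasDerivAt_of_cr
  crOff crDir crSgn crOff_apply_le exists_subseq_tendstoLocallyUniformly exists_partialDeriv_limit
  hasFDerivAt_of_quotient_bounds dist_meshPoint_adj)
open Literature.Probability.RandomPlanarGeometry

variable {Ω : Set ℂ} {δ : ℝ}

open WeakBeurling

open Classical in
/-- **Joint subsequential limits of the potentials and their conjugates form a holomorphic
function of finite Dirichlet energy.** Along any subsequence `k` of the dyadic meshes with
`𝒞(T_{k n} ↔ B_{k n}) → I`, after passing to a further subsequence `φ`: the potentials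
`h_{k φ n}` converge locally uniformly to `v`, their conjugates based at the square of
`c⋆ = xs + ys i` converge locally uniformly to `u`, `f = u + i v` is holomorphic on `Ω` with
`∫∫_Ω ‖f'‖² ≤ I` ([GP19] §4.1: (CRd) in the limit gives the Cauchy–Riemann equations; Fatou as
in Theorem 4.6). [cite: GeorgakopoulosPanagiotis2019, §4.1 and Theorem 4.6] -/
theorem exists_holomorphic_limit' (R : ConformalRectangle) {δs : ℕ → ℝ} (hδ : ∀ n, 0 < δs n) (hδ0 : Tendsto δs atTop (𝓝 0))
    (hdisj : ∀ n, discreteArc R.carrier (δs n) (R.arc 0) ∩ discreteArc R.carrier (δs n) (R.arc 2) = ∅) {I : ℝ≥0∞}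
    (hI : Tendsto (fun n => effectiveConductance (discreteDomainGraph R.carrier (δs n)) 1
      (discreteArc R.carrier (δs n) (R.arc 0))
      (discreteArc R.carrier (δs n) (R.arc 2))) atTop (𝓝 I))
    {xs ys : ℝ} (hc : (⟨xs, ys⟩ : ℂ) ∈ R.carrier) :
    ∃ h : ℕ → Site 2 → ℝ,
      (∀ n, (discreteArc R.carrier (δs n) (R.arc 0)).EqOn (h n) 1 ∧
        (discreteArc R.carrier (δs n) (R.arc 2)).EqOn (h n) 0 ∧
        (∀ x, h n x ∈ Icc (0 : ℝ) 1) ∧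
        networkEnergy (discreteDomainGraph R.carrier (δs n)) 1 (h n) =
          effectiveConductance (discreteDomainGraph R.carrier (δs n)) 1
            (discreteArc R.carrier (δs n) (R.arc 0)) (discreteArc R.carrier (δs n) (R.arc 2)) ∧
        ∀ x, x ∉ discreteArc R.carrier (δs n) (R.arc 0) → x ∉ discreteArc R.carrier (δs n) (R.arc 2) →
          ∑ y ∈ ((zdGraph 2).neighborFinset x).filter (fun y => (discreteDomainGraph R.carrier (δs n)).Adj x y),
            (h n y - h n x) = 0) ∧
      ∃ φ : ℕ → ℕ, StrictMono φ ∧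
      ∃ f : ℂ → ℂ, DifferentiableOn ℂ f R.carrier ∧
        (∫⁻ w in R.carrier, ‖deriv f w‖ₑ ^ 2) ≤ I ∧
        ∀ z ∈ R.carrier, ∃ s > 0, TendstoUniformlyOn
          (fun n w => facePot R.carrier (δs (φ n)) (h (φ n))
            ![⌊xs / δs (φ n)⌋, ⌊ys / δs (φ n)⌋]
            (nearestSite (δs (φ n)) w))
          (fun w => (f w).re) atTop (ball z s) := by
  classical
  have hΩo : IsOpen R.carrier := R.isOpen
  have hΩc : IsConnected R.carrier := R.isConnected
  have hne : R.carrierᶜ.Nonempty := ⟨R.boundary 0, fun h =>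
    (R.disjoint_carrier_frontier.ne_of_mem h (R.boundary_mem_frontier 0)) rfl⟩
  -- the potentials `h_n`
  choose h hT hB h01 hE hharm using fun n => exists_g02Potential R (hδ n) (hdisj n)
  refine ⟨h, fun n => ⟨hT n, hB n, h01 n, hE n, hharm n⟩, ?_⟩
  have hTsub : ∀ n, discreteArc R.carrier (δs n) (R.arc 0) ⊆ meshBoundary R.carrier (δs n) :=
    fun n x hx => hx.1
  have hBsub : ∀ n, discreteArc R.carrier (δs n) (R.arc 2) ⊆ meshBoundary R.carrier (δs n) :=
    fun n x hx => hx.1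
  -- equi-Lipschitz bound in the bulk (Thm 4.3)
  have hL : ∀ z ∈ R.carrier, ∃ r > 0, ∃ L ≥ (0 : ℝ), ∀ᶠ n in atTop, ∀ x y : Site 2, meshPoint (δs n) x ∈ ball z r → meshPoint (δs n) y ∈ ball z r →
        |h n x - h n y| ≤
          L * dist (meshPoint (δs n) x) (meshPoint (δs n) y) := by
    intro z hz
    obtain ⟨r₀, hr₀, hzr₀⟩ := Metric.nhds_basis_closedBall.mem_iff.1 (hΩo.mem_nhds hz)
    obtain ⟨δ₀, hδ₀, H⟩ :=
      exists_forall_abs_sub_le_mul_dist' R hr₀ hzr₀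
    have hK := topGradConst_pos
    refine ⟨r₀ / 16, by positivity, 64 * topGradConst / r₀, by positivity, ?_⟩
    filter_upwards [(tendsto_order.1 hδ0).2 _ hδ₀] with n hn x y hx hy
    exact H _ (hδ n) hn (h n) (h01 n) (hharm n) x y hx hy
  -- first extraction: the potentials
  obtain ⟨φ₁, hφ₁, -, v, -, hvloc₁⟩ := exists_subseq_tendstoLocallyUniformly hΩo hδ hδ0 h01 hL (fun _ => (0 : ℝ≥0∞))
  have hδ₁ : ∀ n, (0 : ℝ) < δs (φ₁ n) := fun n => hδ (φ₁ n)
  have hδ₁0 : Tendsto (fun n => δs (φ₁ n)) atTop (𝓝 0) := hδ0.comp hφ₁.tendsto_atTop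
  -- the conjugates along `φ₁`, squashed into `[0,1]`
  set p₀ : ℕ → Site 2 := fun n => ![⌊xs / δs n⌋, ⌊ys / δs n⌋] with hp₀
  set Hc : ℕ → Site 2 → ℝ := fun n x => facePot R.carrier (δs n) (h n) (p₀ n) x with hHc
  have hp₀inner : ∀ z ∈ R.carrier, ∀ᶠ n in atTop, IsInnerFace R.carrier (δs n) (p₀ n) := by
    intro z hz
    obtain ⟨s₀, -, δ₀, hδ₀, Hr⟩ := exists_forall_reachable_near R hc hz
    filter_upwards [(tendsto_order.1 hδ0).2 _ hδ₀] with n hn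
    exact (Hr _ (hδ n) hn).1
  have hL' : ∀ z ∈ R.carrier, ∃ r > 0, ∃ L ≥ (0 : ℝ), ∀ᶠ n in atTop, ∀ x y : Site 2,
      meshPoint (δs (φ₁ n)) x ∈ ball z r → meshPoint (δs (φ₁ n)) y ∈ ball z r →
        |sqz (Hc (φ₁ n) x) - sqz (Hc (φ₁ n) y)| ≤
          L * dist (meshPoint (δs (φ₁ n)) x) (meshPoint (δs (φ₁ n)) y) := by
    intro z hz
    obtain ⟨r₀, hr₀, hzr₀⟩ := Metric.nhds_basis_closedBall.mem_iff.1 (hΩo.mem_nhds hz)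
    obtain ⟨δ₀, hδ₀, H⟩ := exists_forall_abs_facePot_sub_le_mul_dist R hr₀ hzr₀
    have hK := topGradConst_pos
    refine ⟨r₀ / 32, by positivity, 64 * topGradConst / r₀, by positivity, ?_⟩
    filter_upwards [(tendsto_order.1 hδ₁0).2 _ hδ₀, (hp₀inner z hz).filter_mono (hφ₁.tendsto_atTop)]
      with n hn hp x y hx hy
    exact (abs_sqz_sub_sqz_le _ _).trans (H _ (hδ₁ n) hn (h (φ₁ n)) (h01 (φ₁ n)) (hharm (φ₁ n)) (p₀ (φ₁ n)) hp x y hx hy)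
  -- second extraction: the squashed conjugates
  obtain ⟨φ₂, hφ₂, -, ut, -, hutloc⟩ := exists_subseq_tendstoLocallyUniformly hΩo hδ₁ hδ₁0
    (h := fun n x => sqz (Hc (φ₁ n) x)) (fun n x => sqz_mem_Icc _) hL' (fun _ => (0 : ℝ≥0∞))
  set φ : ℕ → ℕ := φ₁ ∘ φ₂ with hφdef
  have hφ : StrictMono φ := hφ₁.comp hφ₂
  refine ⟨φ, hφ, ?_⟩
  have hI' : Tendsto (fun n => effectiveConductance (discreteDomainGraph R.carrier (δs (φ n))) 1 (discreteArc R.carrier (δs (φ n)) (R.arc 0))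
      (discreteArc R.carrier (δs (φ n)) (R.arc 2))) atTop (𝓝 I) := hI.comp hφ.tendsto_atTop
  have hδ' : ∀ n, (0 : ℝ) < δs (φ n) := fun n => hδ (φ n)
  have hδ'0 : Tendsto (fun n => δs (φ n)) atTop (𝓝 0) := hδ0.comp hφ.tendsto_atTop
  -- harmonicity on the boxes of every compact subset, eventually
  have hharmK' : ∀ K ⊆ R.carrier, IsCompact K → ∀ᶠ n in atTop, ∀ (a : Site 2) (N : ℕ),
      Complex.Rectangle (meshPoint (δs (φ n)) a) (meshPoint (δs (φ n)) (a + ![(N : ℤ), (N : ℤ)])) ⊆ K →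
        IsLatticeHarmonicOn (h (φ n)) (boxInterior a N) := by
    intro K hK hKc
    obtain ⟨δ₁, hδ₁, H⟩ := exists_forall_isLatticeHarmonicOn_boxInterior R.toJordanDomain hKc hK
    filter_upwards [(tendsto_order.1 hδ'0).2 _ hδ₁] with n hn a N hsq
    exact H _ (hδ' n) hn _ _ (h (φ n)) (hharm (φ n)) a N hsq
  have hvloc : ∀ z ∈ R.carrier, ∃ r > 0, (∃ L ≥ (0 : ℝ), ∀ w ∈ ball z r, ∀ w' ∈ ball z r, |v w - v w'| ≤ L * dist w w') ∧
      TendstoUniformlyOn (fun n w => h (φ n) (nearestSite (δs (φ n)) w)) v atTop (ball z r) := by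
    intro z hz
    obtain ⟨r, hr, hLip, hconv⟩ := hvloc₁ z hz
    exact ⟨r, hr, hLip, fun u hu => hφ₂.tendsto_atTop.eventually (hconv u hu)⟩
  -- ### the potential side (as in `inv_extremalDistance_le_of_subseq`)
  have hloc : ∀ z ∈ R.carrier, ∃ s > 0, ∃ g₀ g₁ : ℂ → ℝ, ContinuousOn g₀ (ball z s) ∧ ContinuousOn g₁ (ball z s) ∧ TendstoUniformlyOn
        (fun n w => (h (φ n) (nearestSite (δs (φ n)) w + Pi.single 0 1) -
          h (φ n) (nearestSite (δs (φ n)) w)) / δs (φ n)) g₀ atTop (ball z s) ∧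
      TendstoUniformlyOn
        (fun n w => (h (φ n) (nearestSite (δs (φ n)) w + Pi.single 1 1) -
          h (φ n) (nearestSite (δs (φ n)) w)) / δs (φ n)) g₁ atTop (ball z s) ∧
      ∀ w ∈ ball z s, HasFDerivAt v (g₀ w • Complex.reCLM + g₁ w • Complex.imCLM) w :=
    fun z hz => exists_local_hasFDerivAt_of_harmonicOnBoxes hΩo hδ' hδ'0 (H := fun n => h (φ n))
      (fun n => h01 (φ n)) hharmK' hvloc hz
  choose s hs g₀ g₁ hg₀c hg₁c hg₀u hg₁u hF using hloc
  have hfd : ∀ z (hz : z ∈ R.carrier), ∀ w ∈ ball z (s z hz), fderiv ℝ v w = g₀ z hz w • Complex.reCLM + g₁ z hz w • Complex.imCLM :=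
    fun z hz w hw => (hF z hz w hw).fderiv
  have hvc : ContinuousOn (fderiv ℝ v) R.carrier := by
    intro z hz
    have hcont : ContinuousOn (fun w => g₀ z hz w • Complex.reCLM + g₁ z hz w • Complex.imCLM) (ball z (s z hz)) :=
      ((hg₀c z hz).smul continuousOn_const).add ((hg₁c z hz).smul continuousOn_const)
    exact ((hcont.congr fun w hw => hfd z hz w hw).continuousAt
      (ball_mem_nhds z (hs z hz))).continuousWithinAt
  have hDi : ∀ i : Fin 2, ∀ z (hz : z ∈ R.carrier), TendstoUniformlyOn (fun n w => (h (φ n) (nearestSite (δs (φ n)) w + Pi.single i 1) -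
        h (φ n) (nearestSite (δs (φ n)) w)) / δs (φ n))
      (fun w => fderiv ℝ v w (if i = 0 then (1 : ℂ) else Complex.I)) atTop (ball z (s z hz)) := by
    refine Fin.forall_fin_two.2 ⟨fun z hz => ?_, fun z hz => ?_⟩
    · refine (hg₀u z hz).congr_right fun w hw => ?_
      simp only [Fin.isValue, ↓reduceIte]
      rw [hfd z hz w hw]
      simp
    · refine (hg₁u z hz).congr_right fun w hw => ?_
      simp only [Fin.isValue, one_ne_zero, ↓reduceIte]
      rw [hfd z hz w hw]
      simp
  have hD : ∀ i : Fin 2, TendstoLocallyUniformlyOn (fun n w => (h (φ n) (nearestSite (δs (φ n)) w + Pi.single i 1) -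
        h (φ n) (nearestSite (δs (φ n)) w)) / δs (φ n))
      (fun w => fderiv ℝ v w (if i = 0 then (1 : ℂ) else Complex.I)) atTop R.carrier :=
    fun i u hu z hz => ⟨ball z (s z hz), mem_nhdsWithin_of_mem_nhds (ball_mem_nhds z (hs z hz)),
      hDi i z hz u hu⟩
  have hedges : ∀ K' ⊆ R.carrier, IsCompact K' → ∀ᶠ n in atTop, ∀ x : Site 2, meshPoint (δs (φ n)) x ∈ K' → ∀ i : Fin 2,
        s(x, x + (Pi.single i 1 : Site 2)) ∈ (discreteDomainGraph R.carrier (δs (φ n))).edgeSet :=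
    fun K' hK' hK'c => eventually_axisEdges_mem' R.toJordanDomain hδ' hδ'0 hK' hK'c
  have hC : ∀ n, networkEnergy (discreteDomainGraph R.carrier (δs (φ n))) 1 (h (φ n)) ≤
      effectiveConductance (discreteDomainGraph R.carrier (δs (φ n))) 1
        (discreteArc R.carrier (δs (φ n)) (R.arc 0))
        (discreteArc R.carrier (δs (φ n)) (R.arc 2)) := fun n => (hE (φ n)).le
  have hint : ∫⁻ w in R.carrier, ‖fderiv ℝ v w‖ₑ ^ 2 ≤ I :=
    lintegral_norm_fderiv_sq_le' hΩo R.isBounded hδ' hδ'0 (G := fun n => discreteDomainGraph R.carrier (δs (φ n)))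
      (h := fun n => h (φ n)) hedges hC hI' hvc hD
  -- ### the conjugate side: the limit `u`
  set u : ℂ → ℝ := fun w => unsqz (ut w) with hu
  have hU : ∀ z ∈ R.carrier, ∃ s' > 0, TendstoUniformlyOn (fun n w => Hc (φ n) (nearestSite (δs (φ n)) w)) u atTop (ball z s') ∧
      ContinuousOn u (ball z s') := by
    intro z hz
    obtain ⟨r, hr, ⟨Lu, hLu0, hLu⟩, hconv⟩ := hutloc z hz
    obtain ⟨s₁, hs₁, M, δ₀, hδ₀, Hb⟩ := exists_local_bound_facePot R hc hz
    set s' := min r (s₁ / 2) with hs'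
    have hs'pos : 0 < s' := by positivity
    -- eventually the squashed conjugates take values in `[sqz (-M), sqz M]` on the ball
    have hrange : ∀ᶠ n in atTop, ∀ w ∈ ball z s', |Hc (φ n) (nearestSite (δs (φ n)) w)| ≤ M := by
      filter_upwards [(tendsto_order.1 hδ'0).2 _ (lt_min hδ₀ (half_pos hs₁))] with n hn w hw
      have hn₀ : δs (φ n) < δ₀ := hn.trans_le (min_le_left _ _)
      have hn₁ : δs (φ n) < s₁ / 2 := hn.trans_le (min_le_right _ _)
      refine (Hb _ (hδ' n) hn₀ (h (φ n)) (h01 (φ n)) (hharm (φ n))).2 _ ?_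
      rw [Metric.mem_ball] at hw ⊢
      have := dist_meshPoint_nearestSite_le (hδ' n) w
      linarith [dist_triangle (meshPoint (δs (φ n)) (nearestSite (δs (φ n)) w)) w z, min_le_right r (s₁ / 2)]
    have hsqzrange : ∀ᶠ n in atTop, ∀ w ∈ ball z s', sqz (Hc (φ n) (nearestSite (δs (φ n)) w)) ∈ Icc (sqz (-M)) (sqz M) := by
      filter_upwards [hrange] with n hn w hw
      have := abs_le.1 (hn w hw)
      exact ⟨sqz_strictMono.monotone this.1, sqz_strictMono.monotone this.2⟩
    have hutrange : ∀ w ∈ ball z s', ut w ∈ Icc (sqz (-M)) (sqz M) := fun w hw =>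
      isClosed_Icc.mem_of_tendsto (hconv.tendsto_at (ball_subset_ball (min_le_left _ _) hw))
        (hsqzrange.mono fun n hn => hn w hw)
    have hIoo : Icc (sqz (-M)) (sqz M) ⊆ Ioo 0 1 := fun y hy =>
      ⟨(sqz_mem_Ioo _).1.trans_le hy.1, hy.2.trans_lt (sqz_mem_Ioo _).2⟩
    refine ⟨s', hs'pos, ?_, ?_⟩
    · rw [Metric.tendstoUniformlyOn_iff]
      intro ε hε
      obtain ⟨η, hη, hηu⟩ := Metric.uniformContinuousOn_iff.1 (uniformContinuousOn_unsqz (sqz_mem_Ioo (-M)).1 (sqz_mem_Ioo M).2) ε hε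
      filter_upwards [(Metric.tendstoUniformlyOn_iff.1 hconv) η hη, hsqzrange] with n hn hn' w hw
      have h1 := hn w (ball_subset_ball (min_le_left _ _) hw)
      have := hηu _ (hutrange w hw) _ (hn' w hw) h1
      rwa [unsqz_sqz] at this
    · have hutc : ContinuousOn ut (ball z s') := by
        refine Metric.continuousOn_iff.2 fun w hw ε hε => ⟨ε / (Lu + 1), by positivity, fun w' hw' hd => ?_⟩
        have := hLu w' (ball_subset_ball (min_le_left _ _) hw') w (ball_subset_ball (min_le_left _ _) hw)
        rw [Real.dist_eq]
        calc |ut w' - ut w| ≤ Lu * dist w' w := this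
          _ < Lu * (ε / (Lu + 1)) + 1 * (ε / (Lu + 1)) := by nlinarith [dist_nonneg (x := w') (y := w)]
          _ = ε := by field_simp
      exact continuousOn_unsqz.comp hutc fun w hw => hIoo (hutrange w hw)
  -- ### `u` is `C¹` with `∇u = (v_y, -v_x)`
  have hK := topGradConst_pos
  have hCR : ∀ z (hz : z ∈ R.carrier), ∃ ρ > 0, ρ ≤ s z hz ∧ ∀ w ∈ ball z ρ,
      HasFDerivAt u (g₁ z hz w • Complex.reCLM + (-(g₀ z hz w)) • Complex.imCLM) w := by
    intro z hz
    obtain ⟨r₀, hr₀, hzr₀⟩ := Metric.nhds_basis_closedBall.mem_iff.1 (hΩo.mem_nhds hz)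
    obtain ⟨δL, hδL, HLip⟩ := exists_forall_abs_facePot_sub_le_mul_dist R hr₀ hzr₀
    obtain ⟨δ2, hδ2, H2⟩ := exists_forall_abs_facePot_second_diff_le R hr₀ hzr₀
    obtain ⟨sr, hsr, δr, hδr, Hr⟩ := exists_forall_reachable_near R hc hz
    obtain ⟨su, hsu, hconv, hcont⟩ := hU z hz
    set r' := min (r₀ / 64) (min su sr) with hr'
    have hr'pos : 0 < r' := by positivity
    have hr'r₀ : r' ≤ r₀ / 64 := min_le_left _ _
    have hr'su : r' ≤ su := (min_le_right _ _).trans (min_le_left _ _)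
    have hr'sr : r' ≤ sr := (min_le_right _ _).trans (min_le_right _ _)
    -- the inputs of `exists_partialDeriv_limit`
    have hsmall : ∀ᶠ n in atTop, δs (φ n) < min (min δL δ2) (min δr (r₀ / 64)) :=
      (tendsto_order.1 hδ'0).2 _ (by positivity)
    have h1 : ∀ᶠ n in atTop, ∀ x : Site 2, meshPoint (δs (φ n)) x ∈ ball z r' → ∀ kk : Fin 4,
        |Hc (φ n) (x + cornerUnit kk) - Hc (φ n) x| ≤ 64 * topGradConst / r₀ * δs (φ n) := by
      filter_upwards [hsmall] with n hn x hx kk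
      have hnL : δs (φ n) < δL := hn.trans_le ((min_le_left _ _).trans (min_le_left _ _))
      have hnr : δs (φ n) < δr := hn.trans_le ((min_le_right _ _).trans (min_le_left _ _))
      have hn64 : δs (φ n) < r₀ / 64 := hn.trans_le ((min_le_right _ _).trans (min_le_right _ _))
      have hp := (Hr _ (hδ' n) hnr).1
      have hadj : (zdGraph 2).Adj x (x + cornerUnit kk) := adj_of_stepKind (stepKind_add_cornerUnit x kk)
      have hd : dist (meshPoint (δs (φ n)) (x + cornerUnit kk)) (meshPoint (δs (φ n)) x) =
          δs (φ n) := by rw [_root_.dist_comm]; exact dist_meshPoint_adj (hδ' n).le hadj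
      have hx32 : meshPoint (δs (φ n)) x ∈ ball z (r₀ / 32) := ball_subset_ball (by linarith) hx
      have hxk32 : meshPoint (δs (φ n)) (x + cornerUnit kk) ∈ ball z (r₀ / 32) := by
        rw [Metric.mem_ball] at hx ⊢
        linarith [dist_triangle (meshPoint (δs (φ n)) (x + cornerUnit kk)) (meshPoint (δs (φ n)) x) z]
      have := HLip _ (hδ' n) hnL (h (φ n)) (h01 (φ n)) (hharm (φ n)) (p₀ (φ n)) hp _ _ hxk32 hx32
      rwa [hd] at this
    have h2 : ∀ᶠ n in atTop, ∀ x : Site 2, meshPoint (δs (φ n)) x ∈ ball z r' → ∀ j kk : Fin 4,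
        |(Hc (φ n) (x + cornerUnit kk + cornerUnit j) - Hc (φ n) (x + cornerUnit kk)) -
          (Hc (φ n) (x + cornerUnit j) - Hc (φ n) x)| ≤ 4096 * topGradConst ^ 2 / r₀ ^ 2 * (δs (φ n)) ^ 2 := by
      filter_upwards [hsmall] with n hn x hx j kk
      have hn2 : δs (φ n) < δ2 := hn.trans_le ((min_le_left _ _).trans (min_le_right _ _))
      have hnr : δs (φ n) < δr := hn.trans_le ((min_le_right _ _).trans (min_le_left _ _))
      have hp := (Hr _ (hδ' n) hnr).1
      have hx32 : meshPoint (δs (φ n)) x ∈ ball z (r₀ / 32) := ball_subset_ball (by linarith) hx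
      have := H2 _ (hδ' n) hn2 (h (φ n)) (h01 (φ n)) (hharm (φ n)) (p₀ (φ n)) hp x hx32 j kk
      calc _ ≤ 4096 * topGradConst ^ 2 * (δs (φ n)) ^ 2 / r₀ ^ 2 := this
        _ = _ := by ring
    have hL₁ : (0 : ℝ) ≤ 64 * topGradConst / r₀ := by positivity
    have hL₂ : (0 : ℝ) ≤ 4096 * topGradConst ^ 2 / r₀ ^ 2 := by positivity
    obtain ⟨gu₀, hgu₀c, hgu₀u, hq₀⟩ := exists_partialDeriv_limit (z := z) hr'pos hL₁ hL₂ hδ' hδ'0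
      (H := fun n => Hc (φ n)) (hconv.mono (ball_subset_ball hr'su)) (hcont.mono (ball_subset_ball hr'su)) h1 h2 0
    obtain ⟨gu₁, hgu₁c, hgu₁u, hq₁⟩ := exists_partialDeriv_limit (z := z) hr'pos hL₁ hL₂ hδ' hδ'0
      (H := fun n => Hc (φ n)) (hconv.mono (ball_subset_ball hr'su)) (hcont.mono (ball_subset_ball hr'su)) h1 h2 1
    simp only [Fin.isValue, ↓reduceIte, mul_one] at hq₀
    simp only [Fin.isValue, one_ne_zero, ↓reduceIte] at hq₁
    have hFu : ∀ w ∈ ball z (r' / 8), HasFDerivAt u (gu₀ w • Complex.reCLM + gu₁ w • Complex.imCLM) w := fun w hw =>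
      hasFDerivAt_of_quotient_bounds hr'pos (by positivity) hgu₀c hgu₁c (fun w hw s hs hs' => by simpa using hq₀ w hw s hs hs') hq₁ hw
    -- identification of the partial derivatives via (CRd)
    set ρ := min (r' / 8) (s z hz / 2) with hρ
    have hρpos : 0 < ρ := lt_min (by positivity) (half_pos (hs z hz))
    refine ⟨ρ, hρpos, (min_le_right _ _).trans (half_le_self (hs z hz).le), fun w hw => ?_⟩
    have hw8 : w ∈ ball z (r' / 8) := ball_subset_ball (min_le_left _ _) hw
    have hw4 : w ∈ ball z (r' / 4) := ball_subset_ball (by linarith [min_le_left (r' / 8) (s z hz / 2)]) hw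
    have hws : w ∈ ball z (s z hz / 2) := ball_subset_ball (min_le_right _ _) hw
    -- limits of the `u`-quotients at `w`
    have hlim₀ := hgu₀u.tendsto_at hw4
    have hlim₁ := hgu₁u.tendsto_at hw4
    -- the same quotients as shifted `v`-quotients
    have hD1 : Tendsto (fun n => (h (φ n) (nearestSite (δs (φ n)) (w + Complex.ofReal (δs (φ n))) + Pi.single 1 1) -
          h (φ n) (nearestSite (δs (φ n)) (w + Complex.ofReal (δs (φ n))))) / δs (φ n)) atTop (𝓝 (g₁ z hz w)) := by
      have hsz := hs z hz
      refine (hg₁u z hz).tendsto_comp ((hg₁c z hz).continuousWithinAt ?_) ?_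
      · exact ball_subset_ball (by linarith) hws
      · refine tendsto_nhdsWithin_iff.2 ⟨?_, ?_⟩
        · have : Tendsto (fun n => w + Complex.ofReal (δs (φ n))) atTop (𝓝 (w + Complex.ofReal 0)) :=
            tendsto_const_nhds.add (Complex.continuous_ofReal.continuousAt.tendsto.comp hδ'0)
          simpa using this
        · filter_upwards [(tendsto_order.1 hδ'0).2 _ (half_pos hsz)] with n hn
          rw [Metric.mem_ball] at hws ⊢
          have e : dist (w + Complex.ofReal (δs (φ n))) w = δs (φ n) := by
            rw [dist_eq_norm, add_sub_cancel_left, Complex.norm_real, Real.norm_of_nonneg (hδ' n).le]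
          linarith [dist_triangle (w + Complex.ofReal (δs (φ n))) w z]
    have hD0 : Tendsto (fun n => (h (φ n) (nearestSite (δs (φ n)) (w + Complex.ofReal (δs (φ n)) * Complex.I) + Pi.single 0 1) -
          h (φ n) (nearestSite (δs (φ n)) (w + Complex.ofReal (δs (φ n)) * Complex.I))) / δs (φ n)) atTop
          (𝓝 (g₀ z hz w)) := by
      have hsz := hs z hz
      refine (hg₀u z hz).tendsto_comp ((hg₀c z hz).continuousWithinAt ?_) ?_
      · exact ball_subset_ball (by linarith) hws
      · refine tendsto_nhdsWithin_iff.2 ⟨?_, ?_⟩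
        · have : Tendsto (fun n => w + Complex.ofReal (δs (φ n)) * Complex.I) atTop (𝓝 (w + Complex.ofReal 0 * Complex.I)) :=
            tendsto_const_nhds.add ((Complex.continuous_ofReal.continuousAt.tendsto.comp hδ'0).mul_const _)
          simpa using this
        · filter_upwards [(tendsto_order.1 hδ'0).2 _ (half_pos hsz)] with n hn
          rw [Metric.mem_ball] at hws ⊢
          have e : dist (w + Complex.ofReal (δs (φ n)) * Complex.I) w = δs (φ n) := by
            rw [dist_eq_norm, add_sub_cancel_left, norm_mul, Complex.norm_I, mul_one, Complex.norm_real, Real.norm_of_nonneg (hδ' n).le]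
          linarith [dist_triangle (w + Complex.ofReal (δs (φ n)) * Complex.I) w z]
    -- (CRd) at the nearest site of `w`, eventually
    have hCRd : ∀ᶠ n in atTop, (Hc (φ n) (nearestSite (δs (φ n)) w + Pi.single 0 1) - Hc (φ n) (nearestSite (δs (φ n)) w)) / δs (φ n) =
          (h (φ n) (nearestSite (δs (φ n)) (w + Complex.ofReal (δs (φ n))) + Pi.single 1 1) -
            h (φ n) (nearestSite (δs (φ n)) (w + Complex.ofReal (δs (φ n))))) / δs (φ n) ∧
        (Hc (φ n) (nearestSite (δs (φ n)) w + Pi.single 1 1) - Hc (φ n) (nearestSite (δs (φ n)) w)) / δs (φ n) =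
          -((h (φ n) (nearestSite (δs (φ n)) (w + Complex.ofReal (δs (φ n)) * Complex.I) + Pi.single 0 1) -
            h (φ n) (nearestSite (δs (φ n)) (w + Complex.ofReal (δs (φ n)) * Complex.I))) / δs (φ n)) := by
      filter_upwards [(tendsto_order.1 hδ'0).2 _ (lt_min hδr (by positivity : (0 : ℝ) < sr / 4))] with n hn
      have hnr : δs (φ n) < δr := hn.trans_le (min_le_left _ _)
      have hns : δs (φ n) < sr / 4 := hn.trans_le (min_le_right _ _)
      obtain ⟨hp, Hr'⟩ := Hr _ (hδ' n) hnr
      set d := δs (φ n) with hd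
      set y := nearestSite d w with hy
      have hρsr : ρ ≤ sr / 2 := (min_le_left _ _).trans (by linarith [hr'sr])
      have hwsr : dist w z < sr / 2 := by
        have : w ∈ ball z (sr / 2) := ball_subset_ball hρsr hw
        exact Metric.mem_ball.1 this
      have hyw : dist (meshPoint d y) w ≤ d := dist_meshPoint_nearestSite_le (hδ' n) w
      have hnear : ∀ q : Site 2, dist (meshPoint d q) (meshPoint d y) ≤ d → meshPoint d q ∈ ball z sr := by
        intro q hq
        rw [Metric.mem_ball]
        linarith [dist_triangle (meshPoint d q) (meshPoint d y) z, dist_triangle (meshPoint d y) w z]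
      have hyr : (faceGraph R.carrier d).Reachable (p₀ (φ n)) y := (Hr' y (hnear y (by rw [_root_.dist_self]; exact (hδ' n).le))).2
      have hI : ∀ kk : Fin 4, IsInnerFace R.carrier d (y + cornerUnit kk) := fun kk =>
        (Hr' _ (hnear _ (by rw [dist_meshPoint_adj (hδ' n).le (adj_of_stepKind (stepKind_add_cornerUnit y kk)).symm]))).1
      have e0 := facePot_step_eq R (hδ' n) (hTsub (φ n)) (hBsub (φ n)) (hharm (φ n)) hp hyr 0 (hI 0)
      have e1 := facePot_step_eq R (hδ' n) (hTsub (φ n)) (hBsub (φ n)) (hharm (φ n)) hp hyr 1 (hI 1)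
      simp only [crSgn, crOff, crDir, cornerUnit, Fin.isValue, ↓reduceIte, true_or, one_ne_zero, false_or,
        show ¬ ((1 : Fin 4) = 2) by decide, show ¬ ((1 : Fin 4) = 3) by decide] at e0 e1
      have hs0 : nearestSite d (w + d) = y + Pi.single 0 1 := nearestSite_add_right (hδ' n).ne' w
      have hs1 : nearestSite d (w + d * Complex.I) = y + Pi.single 1 1 := nearestSite_add_up (hδ' n).ne' w
      have e0' : Hc (φ n) (y + Pi.single 0 1) - Hc (φ n) y = -1 * (h (φ n) (y + Pi.single 0 1) - h (φ n) (y + Pi.single 0 1 + Pi.single 1 1)) := e0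
      have e1' : Hc (φ n) (y + Pi.single 1 1) - Hc (φ n) y = 1 * (h (φ n) (y + Pi.single 1 1) - h (φ n) (y + Pi.single 1 1 + Pi.single 0 1)) := e1
      rw [hs0, hs1]
      exact ⟨by rw [e0']; ring, by rw [e1']; ring⟩
    -- conclude by uniqueness of limits
    have hgu₀ : gu₀ w = g₁ z hz w := by
      refine tendsto_nhds_unique hlim₀ ?_
      exact hD1.congr' (hCRd.mono fun n hn => hn.1.symm)
    have hgu₁ : gu₁ w = -g₀ z hz w := by
      refine tendsto_nhds_unique hlim₁ ?_
      exact hD0.neg.congr' (hCRd.mono fun n hn => hn.2.symm)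
    have := hFu w hw8
    rwa [hgu₀, hgu₁] at this
  -- ### the holomorphic function
  choose ρ hρ hρs hFu using hCR
  set f : ℂ → ℂ := fun w => (u w : ℂ) + (v w : ℂ) * Complex.I with hf
  have hderiv : ∀ z (hz : z ∈ R.carrier), HasDerivAt f ((g₁ z hz z : ℂ) + (g₀ z hz z : ℂ) * Complex.I) z := fun z hz =>
    hasDerivAt_of_cr (hFu z hz z (mem_ball_self (hρ z hz))) (hF z hz z (mem_ball_self (hs z hz)))
  have hdiff : DifferentiableOn ℂ f R.carrier := fun z hz => (hderiv z hz).differentiableAt.differentiableWithinAt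
  have hnorm : ∀ z ∈ R.carrier, ‖deriv f z‖ₑ = ‖fderiv ℝ v z‖ₑ := by
    intro z hz
    rw [(hderiv z hz).deriv, hfd z hz z (mem_ball_self (hs z hz)), enorm_eq_nnnorm, enorm_eq_nnnorm]
    congr 1
    ext
    rw [coe_nnnorm, coe_nnnorm, norm_smul_reCLM_add_smul_imCLM]
    have e : ((g₁ z hz z : ℂ) + (g₀ z hz z : ℂ) * Complex.I) = ⟨g₁ z hz z, g₀ z hz z⟩ := by
      apply Complex.ext <;> simp
    rw [e, Complex.norm_def, Complex.norm_def, Complex.normSq_mk, Complex.normSq_mk, add_comm]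
  refine ⟨f, hdiff, ?_, fun z hz => ?_⟩
  · calc ∫⁻ w in R.carrier, ‖deriv f w‖ₑ ^ 2 = ∫⁻ w in R.carrier, ‖fderiv ℝ v w‖ₑ ^ 2 :=
          setLIntegral_congr_fun hΩo.measurableSet fun w hw => by rw [hnorm w hw]
      _ ≤ I := hint
  · obtain ⟨s', hs', hconv, -⟩ := hU z hz
    refine ⟨s', hs', hconv.congr_right fun w _ => ?_⟩
    simp [hf]


end KirchhoffSlope

end Summit.CriticalPhenomena.CardyFormulaZ2.Theorems
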